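import Summits.AtomisticToContinuum.Crystallization.Theorems.FrustratedLawDichotomyCellF1Reps

/-!
# FrustratedLawDichotomy · crux `AperiodicFrustratedLawGap` (stmt-AtomisticToContinuum-27623) — class-A K-file skeleton, layer 2f:
the three (272) REPRESENTATIVE ROWS pre-wired for F1 (decomp-a2c hand-2 g47, structural share; KFILE-FORMAT ed2+A §3′/§5′, (272) §5)

(272) `nn_of_reps` / `hf_of_reps` / `fc_of_reps` turn per-REPRESENTATIVE readings (the expensive kernel work: 167 NASH representatives at `L_N 3`,
43 interior representatives) into the per-LABEL rows the (251) master consumes, given nine symmetry hypotheses.  For the F1 cell EIGHT of them are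
now theorems of layers 0–2e: `hB` (`Stab16.nearId_mul`), `hP` (`act_inj`), `hM`/`hMI` (`CellF1Labels.hM/hMI`), `hMIM`, `hnb`/`hnbh` for integer-ball
near lists (`Stab16.ballL_eq`), `ha` (`CellF1Frame.a_act`), `hcov` (`CellF1Reps.hcov_of_subset`, structural).  This file packages them for the
NASH row (the expensive one; the host column of the Bravais F1 cell is the MIRROR column of `…CellHostMirror`/`…CellF1Host`, not the pair-list
`hf_of_reps`): ★ `nn_of_reps_F1` takes ONLY the data hypotheses — the multiplier table `ω` with its equivariance `hω` (census `Y_door_symm`, decided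
in `ℚ` via (285) `castVec_equivar` / hand-1 `castVecZ_div_equivar`), the representative set with `rep16 m ∈ Reps`, and the per-representative readings
`hrep` — over the strain cell `BF1 = {F | |FᵀF − 1| ≤ 2⁻¹⁰}` written as a `Set`; plus the binder-shaped `hB_F1`/`ha_F1`/`hnb_F1`/`hnbh_F1` for
direct calls of the (272) lemmas.  (A restated `hf_of_reps` instance makes the KERNEL unfold the 14k-label set while matching a `Finset.filter`
decidability instance — the KERNEL-GENERIC-M phenomenon of lens-5 l.9589; call (272) `hf_of_reps`/`fc_of_reps` directly with these binders instead.)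
-/

namespace Summit.AtomisticToContinuum.Crystallization.Theorems.FrustratedLawDichotomyCellF1Symm

open scoped BigOperators RealInnerProductSpace
open Summit.AtomisticToContinuum.Crystallization.Theorems.ChargedEnergyGapNegative (E3)
open Summit.AtomisticToContinuum.Crystallization.Theorems.FrustratedLawDichotomyCoherentFloorAlgebra (psiT)
open Summit.AtomisticToContinuum.Crystallization.Theorems.FrustratedLawDichotomyCellTails (certCoeffNearL)
open Summit.AtomisticToContinuum.Crystallization.Theorems.FrustratedLawDichotomyCellMetric (posL)
open Summit.AtomisticToContinuum.Crystallization.Theorems.FrustratedLawDichotomyCellClasses (ballL)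
open Summit.AtomisticToContinuum.Crystallization.Theorems.FrustratedLawDichotomyCellTriples (zT)
open Summit.AtomisticToContinuum.Crystallization.Theorems.FrustratedLawDichotomyCellSymm (nn_of_reps)
open Summit.AtomisticToContinuum.Crystallization.Theorems.FrustratedLawDichotomyCellSymmZ3 (actZ)
open Summit.AtomisticToContinuum.Crystallization.Theorems.FrustratedLawDichotomyCellStab16
  (RZ Rr rep16 symOf16 act_inj ballL_eq nearId_mul)
open Summit.AtomisticToContinuum.Crystallization.Theorems.FrustratedLawDichotomyCellF1Frame (T a_act)
open Summit.AtomisticToContinuum.Crystallization.Theorems.FrustratedLawDichotomyCellF1Labels (MF1 MIF1 MI_subset_M hM hMI)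
open Summit.AtomisticToContinuum.Crystallization.Theorems.FrustratedLawDichotomyCellF1Reps (hcov_of_subset)

/-- the strain cell of the F1 K-file as a set of matrices: `|FᵀF − 1| ≤ 2⁻¹⁰` entrywise. -/
def BF1 : Set (Matrix (Fin 3) (Fin 3) ℝ) := {F | ∀ i j, |(F.transpose * F) i j - (if i = j then 1 else 0)| ≤ 1 / 1024}

/-- membership in the strain cell. -/
theorem mem_BF1 {F : Matrix (Fin 3) (Fin 3) ℝ} : F ∈ BF1 ↔ ∀ i j, |(F.transpose * F) i j - (if i = j then 1 else 0)| ≤ 1 / 1024 := Iff.rfl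

/-- (hB) the strain cell is mapped to itself by every element of `Stab16`. -/
theorem hB_F1 : ∀ k : Fin 16, ∀ F ∈ BF1, F * Rr k ∈ BF1 := fun k _ hF => nearId_mul k hF

/-- (ha) on `MF1`: template equivariance (from layer 1, stated in the binder's shape). -/
theorem ha_F1 : ∀ k : Fin 16, ∀ x ∈ MF1, (T.mulVec fun j => (zT (actZ (RZ k) x) j : ℝ)) = (Rr k).mulVec (T.mulVec fun j => (zT x j : ℝ)) :=
  fun k x _ => a_act k x

/-- (hnb) integer-ball near lists about labels of `MF1` are carried along. -/
theorem hnb_F1 (ℓ : ℤ) : ∀ k : Fin 16, ∀ m ∈ MF1, ballL MF1 zT ℓ (actZ (RZ k) m) = (ballL MF1 zT ℓ m).image (actZ (RZ k)) :=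
  fun k => ballL_eq k (hM k) ℓ

/-- (hnbh) the same over the interior. -/
theorem hnbh_F1 (ℓ : ℤ) : ∀ k : Fin 16, ∀ m ∈ MIF1, ballL MF1 zT ℓ (actZ (RZ k) m) = (ballL MF1 zT ℓ m).image (actZ (RZ k)) :=
  fun k m hm => ballL_eq k (hM k) ℓ m (MI_subset_M hm)

/-- ★ THE F1 NASH ROW FROM REPRESENTATIVES: only the multiplier table (with its equivariance), the representative set of the near list `MN` and the
per-representative readings over the cell remain as hypotheses; near list `nb := ballL MF1 zT ℓn`. -/
theorem nn_of_reps_F1 {ω : ℤ × ℤ × ℤ → Fin 3 → ℝ} (hω : ∀ k : Fin 16, ∀ x ∈ MIF1, ω (actZ (RZ k) x) = (Rr k).mulVec (ω x))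
    (ℓn : ℤ) {MN Reps : Finset (ℤ × ℤ × ℤ)} (hReps : Reps ⊆ MF1) (hR : ∀ m ∈ MN, rep16 m ∈ Reps) (nnTab : ℤ × ℤ × ℤ → ℝ)
    (hrep : ∀ F ∈ BF1, ∀ m₀ ∈ Reps, ‖psiT (‖posL F (T.mulVec fun j => (zT m₀ j : ℝ))‖ ^ 2) • posL F (T.mulVec fun j => (zT m₀ j : ℝ))
        - certCoeffNearL MF1 MIF1 (fun x => posL F (T.mulVec fun j => (zT x j : ℝ))) (fun x => posL F (ω x)) (ballL MF1 zT ℓn) m₀‖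
        ≤ nnTab m₀) :
    ∀ F ∈ BF1, ∀ m ∈ MN, ‖psiT (‖posL F (T.mulVec fun j => (zT m j : ℝ))‖ ^ 2) • posL F (T.mulVec fun j => (zT m j : ℝ))
        - certCoeffNearL MF1 MIF1 (fun x => posL F (T.mulVec fun j => (zT x j : ℝ))) (fun x => posL F (ω x)) (ballL MF1 zT ℓn) m‖
        ≤ nnTab (rep16 m) :=
  nn_of_reps (B := BF1) (Rr := Rr) (Pk := fun k => actZ (RZ k)) (a := fun m => T.mulVec fun j => (zT m j : ℝ)) (symOf := symOf16)
    hB_F1 act_inj hM hMI MI_subset_M (hnb_F1 ℓn) ha_F1 hω hReps (hcov_of_subset hR) nnTab hrep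

end Summit.AtomisticToContinuum.Crystallization.Theorems.FrustratedLawDichotomyCellF1Symm
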